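import Summits.ResolutionOfSingularities.ResolutionOfSingularities.Theorems.FrobeniusClosingSteerNoSatelliteStepTwoBasis
import Summits.ResolutionOfSingularities.ResolutionOfSingularities.Theorems.FrobeniusClosingSteerFreeChainBoundPBasis
import Summits.ResolutionOfSingularities.ResolutionOfSingularities.Theorems.FrobeniusClosingSteerRegularCurveGerm
import Summits.ResolutionOfSingularities.ResolutionOfSingularities.Theorems.FrobeniusClosingSteerGeomChartTwoBasis
import HarnessLib

/-!
# Crux `Steer` (stmt-ResolutionOfSingularities-16345), chain W4.1: **hGW3 ASSEMBLER** — G-geom(3, 2e), `e ≥ 3`, from I″, S_λ and the 2-basis supply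

OURS (campaign `res-hironaka`, rung L ★L-G4, slot W4.1; seat res-L0-w41-stub-2 g6; res-L0-w41-plan-1 RULING 251 (c) GO «cut `geomChain_false_of_pieces`»;
`hGW3-ASSEMBLY-MAP.md` d0970ee959ebaf4a; route of record res-L0-w41-tri-1 TRIAGE v6.18 (I″ + CLAIM R) + res-L0-w41-idea-3 G-GEOM-DIRECT; replaces the role
of no printed item; NOT a statement of the manuscript under review [claim: Hironaka2017, status: under-review]; AI-produced). Theses-free, DEFINITION-FREE
(the one open piece, I″, is a BINDER spelled out, not a `def`).

`GeomAssembly.geomChain_false_of_pieces (he : 3 ≤ e) (hI2)` : the body of the T-line word `NoEternalConstOrderIsolatedChainGeom 2 3 (2e)`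
(`IsGeomChart` unfolded; the three idle binders `hmult`/`hopt`/`hH` of the word OMITTED — the hunk drops them), from
* `hI2`  = res-L0-w41-idea-3's I″ `NonRationalStepNotIsolated (2e)` (`LemmaISketch.lean` v3, audited tri-1 v6.18) VERBATIM at `d := 2e` (kernel: res-L0-w41-stub-3);
and BY NAME: S_λ = res-L0-w41-stub-3's `NoSatelliteStepTwoBasis.span_excParam_eq_of_rational_twoBasis` (p561375), the 2-basis supplies `GeomTwoBasis.exists_twoBasis_residueField_of_chart` / `exists_pFrame_completion_of_chart` (this seat), CLAIM R `ClaimR.geomSupplyRegularCurve_holds` ((K-H)), (K-rank) `GeomChain.geomChartResidueImperfect_holds` (⟹ `κ` infinite),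
`CleaningOptimal.sub_pow_mem_pow_of_law` (cleaned order `≥ 2e` at the near member), **F♭_λ `FreeChainBoundPBasis.not_eternal_free_rational_chain`** (p551861).
PROOF: (A) every step is RATIONAL — else (K-H) + the Bezout seam `δ(2e+1) < q(2e−1)` (from `δ(δ+1) ≤ 2q`, `q ≥ 2`, `e ≥ 3`; at `e = 2` the separable cubic
`(q, δ) = (3, 2)` escapes — that is K3's case and why this cut asks `e ≥ 3`) + I″ contradict `hiso (m+1)`; (B) every step is FREE — S_λ on the window
`m, m+1, m+2, m+3` with the 2-basis of `κ(S (m+1))`; (C) F♭_λ with the dual 2-frame of `κ(Ŝ₀)`. [folklore]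
-/

noncomputable section

set_option linter.dupNamespace false

open IsLocalRing
open Literature.AlgebraicGeometry.Resolution Literature.FieldTheory.Separability
open Summit.ResolutionOfSingularities.ResolutionOfSingularities.Theorems.SwitchingDichotomy
open Summit.ResolutionOfSingularities.ResolutionOfSingularities.Theorems.SwitchingDichotomy.SigmaTopLegality

namespace Summit.ResolutionOfSingularities.ResolutionOfSingularities.Theorems.SwitchingDichotomy.GeomAssembly

/-- The Bezout seam at `e ≥ 3`: `δ(δ+1) ≤ 2q`, `q ≥ 2` ⟹ `δ(2e+1) < q(2e−1)` (no exception; at `e = 2` the pair `(q, δ) = (3, 2)` fails). -/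
theorem star_of_deg_bound_of_three_le {q δ e : ℕ} (hδ : δ * (δ + 1) ≤ 2 * q) (hq : 2 ≤ q) (he : 3 ≤ e) :
    δ * (2 * e + 1) < q * (2 * e - 1) := by
  obtain ⟨e', rfl⟩ : ∃ e', e = e' + 3 := ⟨e - 3, by omega⟩
  have h1 : 2 * (e' + 3) - 1 = 2 * e' + 5 := by omega
  rw [h1]
  rcases Nat.lt_or_ge δ 2 with hlt | hge
  · interval_cases δ <;> nlinarith
  · have hA : δ * (δ + 1) * (2 * e' + 5) ≤ 2 * q * (2 * e' + 5) := Nat.mul_le_mul_right _ hδ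
    have hB : δ * 3 * (2 * e' + 5) ≤ δ * (δ + 1) * (2 * e' + 5) :=
      Nat.mul_le_mul_right _ (Nat.mul_le_mul_left δ (by omega))
    nlinarith [hA, hB, hge, Nat.zero_le (δ * e')]

/-- **hGW3 ASSEMBLER, `e ≥ 3`** (ONE binder: I″). See the module docstring. The conclusion is the body of `NoEternalConstOrderIsolatedChainGeom 2 3 (2*e)` with the word's
three idle binders (`f ≡ □ mod 𝔪²`, cleaned order `≤ 2e`, `HasCleaningDerivations`) omitted. [folklore] -/
theorem geomChain_false_of_pieces {e : ℕ} (he : 3 ≤ e)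
    (hI2 : ∀ (L : Type) [Field L] [CharP L 2]
      (S₀ S₁ : Subring L) [IsLocalRing S₀] [IsLocalRing S₁] (h₀₁ : S₀ ≤ S₁)
      (f₀ g₀ G : S₀) (f₁ x₀ w : S₁) (q δ : ℕ) (u : Fin q → S₁),
      IsRegularLocalRing S₀ → IsRegularLocalRing S₁ → IsExcellentRing S₁ →
      ringKrullDim S₀ = 3 → ringKrullDim S₁ = 3 →
      IsQuadraticTransform S₀ S₁ →
      Ideal.span ((fun y : S₀ => (⟨(y : L), h₀₁ y.2⟩ : S₁)) '' (maximalIdeal S₀ : Set S₀)) = Ideal.span {x₀} →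
      Even (2 * e) →
      ((f₁ : S₁) : L) * ((x₀ : S₁) : L) ^ (2 * e) = ((f₀ : S₀) : L) - ((g₀ : S₀) : L) ^ 2 →
      (∃ g₁ : S₁, f₁ - g₁ ^ 2 ∈ maximalIdeal S₁ ^ (2 * e)) →
      (∀ a : Fin q → S₀, (∑ i, (⟨((a i : S₀) : L), h₀₁ (a i).2⟩ : S₁) * u i) ∈ maximalIdeal S₁ →
        ∀ i, a i ∈ maximalIdeal S₀) →
      G ∈ maximalIdeal S₀ ^ δ → ((G : S₀) : L) = ((w : S₁) : L) * ((x₀ : S₁) : L) ^ δ →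
      (Ideal.span ({x₀, w} : Set S₁)).IsPrime →
      IsRegularLocalRing (S₁ ⧸ Ideal.span ({x₀, w} : Set S₁)) →
      ringKrullDim (S₁ ⧸ Ideal.span ({x₀, w} : Set S₁)) = 1 →
      δ * (2 * e + 1) < q * (2 * e - 1) →
      ¬ HasIsolatedSingularity (RadicandRing S₁ 2 f₁)) :
    ∀ (k L : Type) [Field k] [PerfectField k] [Field L] [CharP L 2] [Algebra k L]
      (S : ℕ → Subring L) [∀ m, IsLocalRing (S m)]
      (hle : ∀ m, S m ≤ S (m + 1)) (f g : ∀ m, S m) (x : ∀ m, S (m + 1)),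
      (∀ m, ∃ (A : Subalgebra k L) (Q : Ideal A), A.FG ∧ Q.IsPrime ∧ (∃ Q' : Ideal A, Q'.IsPrime ∧ Q < Q') ∧
        ∀ z : L, z ∈ S m ↔ ∃ a b : A, b ∉ Q ∧ z = (a : L) / (b : L)) →
      (∀ m, IsRegularLocalRing (S m)) → (∀ m, IsExcellentRing (S m)) → (∀ m, ringKrullDim (S m) = (3 : ℕ)) →
      (∀ m, IsQuadraticTransform (S m) (S (m + 1))) →
      (∀ m, Ideal.span ((fun y : S m => (⟨(y : L), hle m y.2⟩ : S (m + 1))) '' (maximalIdeal (S m) : Set (S m)))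
          = Ideal.span {x m}) →
      (∀ m, ((f (m + 1) : S (m + 1)) : L) * ((x m : S (m + 1)) : L) ^ (2 * e) =
          ((f m : S m) : L) - ((g m : S m) : L) ^ 2) →
      (∀ m, HasIsolatedSingularity (RadicandRing (S m) 2 (f m))) →
      False := by
  intro k L _ _ _ _ _ S _ hle f g x hgeom hreg hexc hdim hqt hspan hlaw hiso
  classical
  haveI : Fact (Nat.Prime 2) := ⟨Nat.prime_two⟩
  haveI : ∀ m, IsRegularLocalRing (S m) := hreg
  haveI : CharP k 2 := (algebraMap k L).charP (algebraMap k L).injective 2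
  have hdim' : ∀ m, ringKrullDim (S m) = 3 := fun m => by rw [hdim m]; rfl
  -- ### (A) every step is rational
  have hrat : ∀ m (z : S (m + 1)), ∃ s : S m, z - ⟨(s : L), hle m s.2⟩ ∈ maximalIdeal (S (m + 1)) := by
    intro m
    by_contra hnr
    simp only [not_forall, not_exists] at hnr
    obtain ⟨A, Q, hA, hQ, hQ', hS⟩ := hgeom m
    have hinf : Infinite (ResidueField (S m)) := by
      refine not_finite_iff_infinite.mp fun hfin => ?_
      exact GeomChain.geomChartResidueImperfect_holds 2 k L Nat.prime_two A Q (S m) hA hQ hQ' hS inferInstance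
    obtain ⟨q, δ, u, G, w, hq2, hqind, -, hG, hGw, hWp, hWreg, hWdim, hδ⟩ :=
      ClaimR.geomSupplyRegularCurve_holds L (S m) (S (m + 1)) (hle m) (x m) (hreg m) (hreg (m + 1)) (hexc m) (hdim' m) (hdim' (m + 1))
        (hqt m) (hspan m) hinf hnr
    have hord : ∃ g₁ : S (m + 1), f (m + 1) - g₁ ^ 2 ∈ maximalIdeal (S (m + 1)) ^ (2 * e) :=
      ⟨g (m + 1), CleaningOptimal.sub_pow_mem_pow_of_law 2 (hreg (m + 1)) (hqt (m + 1)) (hle (m + 1)) (f (m + 1)) (g (m + 1)) (f (m + 2))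
        (x (m + 1)) e (hspan (m + 1)) (hlaw (m + 1))⟩
    exact hI2 L (S m) (S (m + 1)) (hle m) (f m) (g m) G (f (m + 1)) (x m) w q δ u (hreg m) (hreg (m + 1)) (hexc (m + 1))
      (hdim' m) (hdim' (m + 1)) (hqt m) (hspan m) (even_two_mul e) (hlaw m) hord hqind hG hGw hWp hWreg hWdim
      (star_of_deg_bound_of_three_le hδ hq2 he) (hiso (m + 1))
  -- ### (B) every step is free (no satellite window)
  have hfree : ∀ m, Ideal.span {(⟨((x m : S (m + 1)) : L), hle (m + 1) (x m).2⟩ : S (m + 2))} = Ideal.span {x (m + 1)} := by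
    intro m
    obtain ⟨A, Q, hA, hQ, -, hS⟩ := hgeom (m + 1)
    exact NoSatelliteStepTwoBasis.span_excParam_eq_of_rational_twoBasis 3 e (by norm_num) (by omega) (hle m) (hle (m + 1)) (hle (m + 2))
      (hreg m) (hreg (m + 1)) (hreg (m + 2))
      (hdim m) (hdim (m + 1)) (hdim (m + 2)) (hqt m) (hqt (m + 1)) (hqt (m + 2))
      (f m) (g m) (f (m + 1)) (g (m + 1)) (f (m + 2)) (g (m + 2)) (f (m + 3)) (x m) (x (m + 1)) (x (m + 2))
      (hspan m) (hspan (m + 1)) (hspan (m + 2)) (hlaw m) (hlaw (m + 1)) (hlaw (m + 2))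
      (GeomTwoBasis.exists_twoBasis_residueField_of_chart k L A Q (S (m + 1)) hA hQ hS) (hexc (m + 1)) (hiso (m + 1)) (hrat m) (hrat (m + 1))
  -- ### (C) Lemma F♭_λ
  obtain ⟨A, Q, hA, hQ, -, hS⟩ := hgeom 0
  obtain ⟨r, γ, D, hBγ, hdual⟩ := GeomTwoBasis.exists_pFrame_completion_of_chart k L A Q (S 0) hA hQ hS
  haveI : CharP (AdicCompletion (maximalIdeal (S 0)) (S 0)) 2 := RadicandCohenFrame.charP_adicCompletion 2 (S 0)
  haveI : CharP (ResidueField (AdicCompletion (maximalIdeal (S 0)) (S 0))) 2 := RadicandCohenFrame.charP_residueField 2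
  have hgen := TwoBasis.pAdjoin_eq_top_of_isTwoBasis γ hBγ
  exact FreeChainBoundPBasis.not_eternal_free_rational_chain e (by omega) S hle f g x hreg (hexc 0) hdim hqt hspan hlaw (hiso 0) hfree hrat
    γ D hdual hgen

end Summit.ResolutionOfSingularities.ResolutionOfSingularities.Theorems.SwitchingDichotomy.GeomAssembly

end
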